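/-
Copyright (c) 2026 the pub-hodgecm-mathlib formalisation cell (harness21).  Prover seat hodgecm-mathlib-K2E4-p11 (g4), Track B ∕ K2-LIT, h413 =
`stmt-HodgeConjecture-24833`, line `K2_E1_TraceFormulaBeta`, campaign «EIS-RANK-ONE», rung R6d₃, deal (D2-f) of K2E1-plan (g4) 2026-09-04T06:42:41Z, FILE 1∕2:
the CENTRE-LINE MASS `N(X) = ∫_{𝔸_F} H(ι(w₀)·u(X, θ t)·g)^σ dμ_F(t)` of the height section on `U(J₃)` is finite, by Eisenstein domination at EVERY point.
-/
import Summits.HodgeConjecture.HodgeConjecture.Theorems.K2E1BorelEisensteinModerateGrowth    -- ★ p857765 (K2E1-p08 (g5)): `exists_siegel_cover_tsum_borelHeight_rpow_le_three` (moderate growth on a Siegel set, `G(F)·𝔖 = G(𝔸)`)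
import Summits.HodgeConjecture.HodgeConjecture.Theorems.K2E1FlatSectionLineRestrictionU3      -- ★ p857785 FILE A (K2E4-p11 (g3)): `heisChart_zero_mul`, `exists_unipotentU_toAdelic_eq_heisChart`, `injective_borelQuotient_weylLongU_mul`
import HarnessLib

/-!
# h413 ∕ Track B «K2-LIT», «EIS-RANK-ONE» R6d₃ (D2-f) FILE 1∕2 — `K2E1CentreLineMassU3`: Eisenstein domination at every point of `U(J₃)(𝔸_F)`,
# the `N(F)`-shell as a sub-sum, and the finiteness of the centre-line mass `∫_{𝔸_F} H(ι(w₀)·u(X, θ t)·g)^σ dμ_F(t)`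

Cell `pub/hodgecm-mathlib`, crux H413 = `stmt-HodgeConjecture-24833`, route `HCCMUnconditional`; dealer K2E1-plan (g4), deal (D2-f) 2026-09-04T06:42:41Z (the `hshell` payer of
the (D2-e) assembly `K2E1EisensteinMinusConstantTermBoundedCMThree`), REPORT-FIRST 06:49:46Z.  THEOREMS ONLY (no `def`, no `instance`, no `notation`, no named-fact hypothesis,
no `sorry`); lane `--kind proof --supports stmt-HodgeConjecture-24833 --as helper` (count-neutral).  Generic quadratic `(F, E, c)` with `c² = 1 ≠ c`, `δ ∈ E⁻ ∖ 0`, and the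
Iwasawa decomposition `hIw` of ★ p857765's letters; `u = heisChart hc`, `θ = traceZeroLine F E c hcδ hδ`, `ι(w₀) = toAdelic (weylLongU …)`, `H = borelHeight`, `γ̃_q = toAdelic q.out`.
* §1 **`exists_forall_tsum_borelHeight_rpow_le_max_three`** — EISENSTEIN DOMINATION AT EVERY POINT: for `τ > 2` ONE `A₁ ≥ 0` with `Summable (q ↦ H(γ̃_q y)^τ)` and
  `Σ'_q H(γ̃_q y)^τ ≤ A₁ · max(H y, (H y)⁻¹)^τ` for EVERY `y ∈ G(𝔸_F)` (★ p857765 on a Siegel set `𝔖` with `G(F)·𝔖 = G(𝔸)`, automorphy of the height series by the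
  reindexing `q ↦ q·γ₀` (★ `rightMulQuot`, ★ `apply_out_mk`), and the ceiling ★ `borelHeight_toAdelic_mul_le_max_three` `H(γ̃ y) ≤ max(H y, (H y)⁻¹)`).
* §2 **`exists_forall_tsum_prod_borelHeight_heisChart_rpow_le_three`** — THE `N(F)`-SHELL AS A SUB-SUM (`ℝ≥0∞`): `Σ'_{(x₀,ξ) ∈ E × F} H(ι(w₀)·u((x₀)_𝔸, θ ξ_𝔸)·y)^τ
  ≤ A₁ · max(H y, (H y)⁻¹)^τ` — the cosets `[w₀ u(x₀, ξδ)]` are pairwise distinct (★ FILE A §1) and `Σ` over an injection is `≤` the full sum (Mathlib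
  `ENNReal.tsum_comp_le_tsum_of_injective`).
* §3 **`exists_forall_lintegral_centreLine_borelHeight_rpow_le_three`** — THE CENTRE-LINE MASS IS FINITE, for EVERY `X ∈ 𝔸_E` and EVERY `g`:
  `∫⁻_{𝔸_F} H(ι(w₀)·u(X, θ t)·g)^σ dμ_F ≤ μ_F(D_F) · A₁ · max(H g, (H g)⁻¹)^σ` (unfold `𝔸_F = ⨆_ξ (ξ + D_F)` ★ `isAddFundamentalDomain_adeleFundamentalDomain`, the centre is
  central `u(X, θ(ξ + t)) = u(0, θ ξ)·u(X, θ t)` ★ `heisChart_zero_mul`, `H(u y) = H(y)` ★, and §2 at the base point `u(X, θ t)·g`); hence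
  **`integrable_centreLine_borelHeight_rpow_three`** and the Bochner form **`exists_forall_integral_centreLine_borelHeight_rpow_le_three`** — the `h𝓔i` ∕ `h𝓔N` letters of ★ PART II
  p857895 `exists_fibre_majorant_centre_of_archSmooth_three` for the envelope `𝓔 = C·H^σ` (edition (D2-e)-B instantiates `N X := C·(μ_F(D_F)·A₁·…)` or the integral itself).
FILE 2∕2 `K2E1CentreLineShellSumU3` sums the mass over the dilated shifted lattice `l₁(E − Y)` (the `hshell` binder).
HONEST LABEL.  Count-neutral helper; proves no printed statement; HC_CM is proved only modulo the 7 printed citations (2 remaining named inputs: hLiu418 =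
`stmt-HodgeConjecture-24832`, h413 = `stmt-HodgeConjecture-24833`) until rung 0 closes.

## References
* [MoeglinWaldspurger1995] C. Mœglin, J.-L. Waldspurger, *Spectral decomposition and Eisenstein series* (1995), I.2.13, II.1.5, II.1.7.
* [Garrett2018] P. Garrett, *Modern Analysis of Automorphic Forms by Example* 1 (2018), §2.3, §2.8–§2.9, §3.10–§3.11.
* [Rogawski1990] J. D. Rogawski, *Automorphic Representations of Unitary Groups in Three Variables* (1990), §1.10, §2.2.
* [CasselsFrohlichANT1967] J. Tate, *Fourier analysis in number fields and Hecke's zeta-functions*, in Cassels–Fröhlich (1967), Ch. XV Thm. 4.1.3, Lemma 4.2.4.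
-/

set_option autoImplicit false
set_option linter.dupNamespace false  -- the mandated namespace repeats the summit's segment (`HodgeConjecture.HodgeConjecture`)

noncomputable section

open MeasureTheory Measure Filter Topology NumberField IsDedekindDomain MulAction Set
open Literature.NumberTheory.Automorphic Literature.NumberTheory.Automorphic.UnitaryGroup
open Summit.HodgeConjecture.HodgeConjecture.Cruxes.H413.K2E1BorelEisensteinU
open Summit.HodgeConjecture.HodgeConjecture.Cruxes.H413.K2E1BorelEisensteinGodementU
open Summit.HodgeConjecture.HodgeConjecture.Cruxes.H413.K2E1BorelEisensteinModerateGrowth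
open Summit.HodgeConjecture.HodgeConjecture.Cruxes.H413.K2E1FlatSectionLineRestrictionU3
open scoped ENNReal NNReal Pointwise

namespace Summit.HodgeConjecture.HodgeConjecture.Cruxes.H413.K2E1CentreLineMassU3

variable {F E : Type} [Field F] [NumberField F] [Field E] [NumberField E] [Algebra F E] [Algebra.IsQuadraticExtension F E] {c : E ≃ₐ[F] E}
  {δ : E}

/-! ## §1 Eisenstein domination at every point -/

omit [Algebra.IsQuadraticExtension F E] in
/-- Reindexing the height series by `q ↦ q·γ₀` (★ `rightMulQuot`): the term of `Σ'_q H(γ̃_q · (ι(γ₀) s))^τ` at `q` is the term of `Σ'_q H(γ̃_q · s)^τ` at `q·γ₀` — `H` is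
left-`B(F)`-invariant (★ `borelHeight_toAdelic_mul_of_mem_borelU`), so the representative does not matter (★ `apply_out_mk`). [cite: Garrett2018, §3.10] -/
theorem borelHeight_out_rightMulQuot_mul (γ₀ : ↥(unitaryGroupOfForm (c : E →+* E) ((StdForm.antidiagonal 3).over E))) (s : (quasiSplit F E c 3).Adelic)
    (q : Quotient (orbitRel ↥(borelU (c : E →+* E) ((StdForm.antidiagonal 3).over E)) ↥(unitaryGroupOfForm (c : E →+* E) ((StdForm.antidiagonal 3).over E)))) :
    borelHeight ((quasiSplit F E c 3).toAdelic
        (Quotient.out (rightMulQuot (borelU (c : E →+* E) ((StdForm.antidiagonal 3).over E)) γ₀ q) : ↥(unitaryGroupOfForm (c : E →+* E) ((StdForm.antidiagonal 3).over E))) * s) =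
      borelHeight ((quasiSplit F E c 3).toAdelic (Quotient.out q : ↥(unitaryGroupOfForm (c : E →+* E) ((StdForm.antidiagonal 3).over E))) * ((quasiSplit F E c 3).toAdelic γ₀ * s)) := by
  have hq : rightMulQuot (borelU (c : E →+* E) ((StdForm.antidiagonal 3).over E)) γ₀ q =
      Quotient.mk (orbitRel ↥(borelU (c : E →+* E) ((StdForm.antidiagonal 3).over E)) ↥(unitaryGroupOfForm (c : E →+* E) ((StdForm.antidiagonal 3).over E))) (q.out * γ₀) := by
    conv_lhs => rw [← Quotient.out_eq q]
    rfl
  have h := apply_out_mk (B := borelU (c : E →+* E) ((StdForm.antidiagonal 3).over E))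
    (T := fun γ : ↥(unitaryGroupOfForm (c : E →+* E) ((StdForm.antidiagonal 3).over E)) => borelHeight ((quasiSplit F E c 3).toAdelic γ * s))
    (fun b hb γ => by
      have hm : (quasiSplit F E c 3).toAdelic (b * γ) = (quasiSplit F E c 3).toAdelic b * (quasiSplit F E c 3).toAdelic γ := map_mul _ _ _
      change borelHeight ((quasiSplit F E c 3).toAdelic (b * γ) * s) = borelHeight ((quasiSplit F E c 3).toAdelic γ * s)
      rw [hm, mul_assoc, borelHeight_toAdelic_mul_of_mem_borelU hb]) (q.out * γ₀)
  have hm : (quasiSplit F E c 3).toAdelic (q.out * γ₀) = (quasiSplit F E c 3).toAdelic q.out * (quasiSplit F E c 3).toAdelic γ₀ := map_mul _ _ _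
  beta_reduce at h
  rw [hq, h, hm, mul_assoc]

/-- **EISENSTEIN DOMINATION AT EVERY POINT OF `U(J₃)(𝔸_F)`.**  `[E:F] = 2`, `c² = 1 ≠ c`, Iwasawa `hIw`, `τ > 2`.  There is ONE `A₁ ≥ 0` such that for EVERY `y ∈ G(𝔸_F)` the
height series over `B(F)∖G(F)` converges and `Σ'_q H(γ̃_q y)^τ ≤ A₁ · max(H y, (H y)⁻¹)^τ`: ★ p857765 gives the bound `A₁·H(s)^τ` on a Siegel set `𝔖` with `G(F)·𝔖 = G(𝔸)`; for `y = ι(γ₀)·s` the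
series at `y` is the series at `s` reindexed by `q ↦ q·γ₀` (§1 `borelHeight_out_rightMulQuot_mul`, Mathlib `Equiv.summable_iff` ∕ `Equiv.tsum_eq`), and `H(s) = H(ι(γ₀⁻¹) y) ≤ max(H y, (H y)⁻¹)`
(★ ceiling). [cite: MoeglinWaldspurger1995, II.1.5 and I.2.13] [cite: Garrett2018, §2.3, §3.10–3.11] -/
theorem exists_forall_tsum_borelHeight_rpow_le_max_three (hc : c * c = 1) (hc1 : c ≠ 1)
    (hIw : ∀ g : (quasiSplit F E c 3).Adelic, ∃ b ∈ borelAdelic F E c 3, ∃ k : (quasiSplit F E c 3).Adelic,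
      adelicVal F E c 3 ((StdForm.antidiagonal 3).over E) k ∈ standardMaximalCompactGL 3 E ∧ g = b * k)
    {τ : ℝ} (hτ : 2 < τ) :
    ∃ A₁ : ℝ, 0 ≤ A₁ ∧ ∀ y : (quasiSplit F E c 3).Adelic,
      Summable (fun q : Quotient (orbitRel ↥(borelU (c : E →+* E) ((StdForm.antidiagonal 3).over E)) ↥(unitaryGroupOfForm (c : E →+* E) ((StdForm.antidiagonal 3).over E))) =>
        ((borelHeight ((quasiSplit F E c 3).toAdelic (Quotient.out q : ↥(unitaryGroupOfForm (c : E →+* E) ((StdForm.antidiagonal 3).over E))) * y) : ℝ)) ^ τ) ∧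
      ∑' q : Quotient (orbitRel ↥(borelU (c : E →+* E) ((StdForm.antidiagonal 3).over E)) ↥(unitaryGroupOfForm (c : E →+* E) ((StdForm.antidiagonal 3).over E))),
          ((borelHeight ((quasiSplit F E c 3).toAdelic (Quotient.out q : ↥(unitaryGroupOfForm (c : E →+* E) ((StdForm.antidiagonal 3).over E))) * y) : ℝ)) ^ τ ≤
        A₁ * ((max (borelHeight y) (borelHeight y)⁻¹ : ℝ≥0) : ℝ) ^ τ := by
  obtain ⟨𝔖, hcov, A₁, hA₁, h𝔖⟩ := exists_siegel_cover_tsum_borelHeight_rpow_le_three (Algebra.IsQuadraticExtension.finrank_eq_two F E) hc hc1 hIw hτ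
  refine ⟨A₁, hA₁, fun y => ?_⟩
  have hy : y ∈ ((quasiSplit F E c 3).arithmeticSubgroup : Set (quasiSplit F E c 3).Adelic) * 𝔖 := by rw [hcov]; exact Set.mem_univ y
  obtain ⟨γ, hγ, s, hs, rfl⟩ := Set.mem_mul.1 hy
  obtain ⟨γ₀, rfl⟩ := hγ
  obtain ⟨hsum, hle⟩ := h𝔖 s hs
  set e := rightMulQuot (borelU (c : E →+* E) ((StdForm.antidiagonal 3).over E)) γ₀ with he
  set T : Quotient (orbitRel ↥(borelU (c : E →+* E) ((StdForm.antidiagonal 3).over E)) ↥(unitaryGroupOfForm (c : E →+* E) ((StdForm.antidiagonal 3).over E))) → ℝ :=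
    fun q => ((borelHeight ((quasiSplit F E c 3).toAdelic (Quotient.out q : ↥(unitaryGroupOfForm (c : E →+* E) ((StdForm.antidiagonal 3).over E))) * s) : ℝ)) ^ τ with hT
  have hre : (fun q : Quotient (orbitRel ↥(borelU (c : E →+* E) ((StdForm.antidiagonal 3).over E)) ↥(unitaryGroupOfForm (c : E →+* E) ((StdForm.antidiagonal 3).over E))) =>
      ((borelHeight ((quasiSplit F E c 3).toAdelic (Quotient.out q : ↥(unitaryGroupOfForm (c : E →+* E) ((StdForm.antidiagonal 3).over E))) *
        ((quasiSplit F E c 3).toAdelic γ₀ * s)) : ℝ)) ^ τ) = T ∘ e := by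
    funext q
    simp only [hT, he, Function.comp_apply, borelHeight_out_rightMulQuot_mul]
  -- `H(s) ≤ max (H y) (H y)⁻¹` for `y = ι(γ₀) s`
  have hceil : borelHeight s ≤ max (borelHeight ((quasiSplit F E c 3).toAdelic γ₀ * s)) (borelHeight ((quasiSplit F E c 3).toAdelic γ₀ * s))⁻¹ := by
    have h := borelHeight_toAdelic_mul_le_max_three γ₀⁻¹ ((quasiSplit F E c 3).toAdelic γ₀ * s)
    rwa [map_inv, inv_mul_cancel_left] at h
  refine ⟨?_, ?_⟩
  · rw [hre]; exact (e.summable_iff).2 hsum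
  · rw [hre]
    calc ∑' q, (T ∘ e) q = ∑' q, T q := e.tsum_eq T
      _ ≤ A₁ * ((borelHeight s : ℝ)) ^ τ := hle
      _ ≤ A₁ * ((max (borelHeight ((quasiSplit F E c 3).toAdelic γ₀ * s)) (borelHeight ((quasiSplit F E c 3).toAdelic γ₀ * s))⁻¹ : ℝ≥0) : ℝ) ^ τ :=
          mul_le_mul_of_nonneg_left (Real.rpow_le_rpow (NNReal.coe_nonneg _) (NNReal.coe_le_coe.2 hceil) (by linarith)) hA₁

/-! ## §2 The `N(F)`-shell `{[w₀ u(x₀, ξδ)]}` as a sub-sum of the height series -/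

/-- **THE `N(F)`-SHELL IS DOMINATED BY THE EISENSTEIN SERIES** (`ℝ≥0∞` currency): for `τ > 2` ONE `A₁ ≥ 0` with
`Σ'_{(x₀, ξ) ∈ E × F} H(ι(w₀)·u((x₀)_𝔸, θ ξ_𝔸)·y)^τ ≤ A₁ · max(H y, (H y)⁻¹)^τ` for EVERY `y`: `ι(w₀)·u((x₀)_𝔸, θ ξ_𝔸) = ι(w₀ · n(x₀, ξ))` with `n(x₀, ξ) ∈ N(F)` (★ FILE A
`exists_unipotentU_toAdelic_eq_heisChart`), the cosets `[w₀ n(x₀, ξ)]` are pairwise distinct (★ `injective_borelQuotient_weylLongU_mul`), the term at a coset does not depend on the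
representative (★ `apply_out_mk`), and a sum over an injection is at most the full sum (§1). [cite: MoeglinWaldspurger1995, II.1.7] [cite: Rogawski1990, §1.10] [cite: Garrett2018, §2.8–§2.9] -/
theorem exists_forall_tsum_prod_borelHeight_heisChart_rpow_le_three (hc : c * c = 1) (hc1 : c ≠ 1) (hcδ : c δ = -δ) (hδ : δ ≠ 0)
    (hIw : ∀ g : (quasiSplit F E c 3).Adelic, ∃ b ∈ borelAdelic F E c 3, ∃ k : (quasiSplit F E c 3).Adelic,
      adelicVal F E c 3 ((StdForm.antidiagonal 3).over E) k ∈ standardMaximalCompactGL 3 E ∧ g = b * k)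
    {τ : ℝ} (hτ : 2 < τ) :
    ∃ A₁ : ℝ, 0 ≤ A₁ ∧ ∀ y : (quasiSplit F E c 3).Adelic,
      ∑' p : E × F, ENNReal.ofReal (((borelHeight (((quasiSplit F E c 3).toAdelic (weylLongU (c : E →+* E) (rfl : ((StdForm.antidiagonal 3).over E) = ((StdForm.antidiagonal 3).over E)))) *
          ((heisChart hc (algebraMap E (AdeleRing (𝓞 E) E) p.1, traceZeroLine F E c hcδ hδ (algebraMap F (AdeleRing (𝓞 F) F) p.2)) : ↥(adelicUnipotent F E c 3)) :
            (quasiSplit F E c 3).Adelic) * y) : ℝ)) ^ τ) ≤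
        ENNReal.ofReal (A₁ * ((max (borelHeight y) (borelHeight y)⁻¹ : ℝ≥0) : ℝ) ^ τ) := by
  classical
  obtain ⟨A₁, hA₁, h⟩ := exists_forall_tsum_borelHeight_rpow_le_max_three hc hc1 hIw hτ
  refine ⟨A₁, hA₁, fun y => ?_⟩
  obtain ⟨hsum, hle⟩ := h y
  -- the rational big-cell elements and their pairwise distinct cosets
  choose nU hnU hmat using fun p : E × F => exists_unipotentU_toAdelic_eq_heisChart hc hcδ hδ p.1 p.2
  set ι : E × F → Quotient (orbitRel ↥(borelU (c : E →+* E) ((StdForm.antidiagonal 3).over E)) ↥(unitaryGroupOfForm (c : E →+* E) ((StdForm.antidiagonal 3).over E))) :=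
    fun p => Quotient.mk _ (weylLongU (c : E →+* E) (rfl : ((StdForm.antidiagonal 3).over E) = ((StdForm.antidiagonal 3).over E)) *
      (nU p : ↥(unitaryGroupOfForm (c : E →+* E) ((StdForm.antidiagonal 3).over E)))) with hι
  have hinj : Function.Injective ι := injective_borelQuotient_weylLongU_mul hδ hmat
  set g : Quotient (orbitRel ↥(borelU (c : E →+* E) ((StdForm.antidiagonal 3).over E)) ↥(unitaryGroupOfForm (c : E →+* E) ((StdForm.antidiagonal 3).over E))) → ℝ :=
    fun q => ((borelHeight ((quasiSplit F E c 3).toAdelic (Quotient.out q : ↥(unitaryGroupOfForm (c : E →+* E) ((StdForm.antidiagonal 3).over E))) * y) : ℝ)) ^ τ with hg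
  have hterm : ∀ p : E × F, ((borelHeight (((quasiSplit F E c 3).toAdelic (weylLongU (c : E →+* E) (rfl : ((StdForm.antidiagonal 3).over E) = ((StdForm.antidiagonal 3).over E)))) *
      ((heisChart hc (algebraMap E (AdeleRing (𝓞 E) E) p.1, traceZeroLine F E c hcδ hδ (algebraMap F (AdeleRing (𝓞 F) F) p.2)) : ↥(adelicUnipotent F E c 3)) :
        (quasiSplit F E c 3).Adelic) * y) : ℝ)) ^ τ = g (ι p) := by
    intro p
    have h := apply_out_mk (B := borelU (c : E →+* E) ((StdForm.antidiagonal 3).over E))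
      (T := fun γ : ↥(unitaryGroupOfForm (c : E →+* E) ((StdForm.antidiagonal 3).over E)) => borelHeight ((quasiSplit F E c 3).toAdelic γ * y))
      (fun b hb γ => by
        have hm : (quasiSplit F E c 3).toAdelic (b * γ) = (quasiSplit F E c 3).toAdelic b * (quasiSplit F E c 3).toAdelic γ := map_mul _ _ _
        change borelHeight ((quasiSplit F E c 3).toAdelic (b * γ) * y) = borelHeight ((quasiSplit F E c 3).toAdelic γ * y)
        rw [hm, mul_assoc, borelHeight_toAdelic_mul_of_mem_borelU hb])
      (weylLongU (c : E →+* E) (rfl : ((StdForm.antidiagonal 3).over E) = ((StdForm.antidiagonal 3).over E)) *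
        (nU p : ↥(unitaryGroupOfForm (c : E →+* E) ((StdForm.antidiagonal 3).over E))))
    have hm : (quasiSplit F E c 3).toAdelic (weylLongU (c : E →+* E) (rfl : ((StdForm.antidiagonal 3).over E) = ((StdForm.antidiagonal 3).over E)) *
          (nU p : ↥(unitaryGroupOfForm (c : E →+* E) ((StdForm.antidiagonal 3).over E)))) =
        (quasiSplit F E c 3).toAdelic (weylLongU (c : E →+* E) (rfl : ((StdForm.antidiagonal 3).over E) = ((StdForm.antidiagonal 3).over E))) *
          (quasiSplit F E c 3).toAdelic (nU p : ↥(unitaryGroupOfForm (c : E →+* E) ((StdForm.antidiagonal 3).over E))) := map_mul _ _ _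
    beta_reduce at h
    simp only [hg, hι]
    rw [h, hm, hnU p]
  calc ∑' p : E × F, ENNReal.ofReal (((borelHeight (((quasiSplit F E c 3).toAdelic (weylLongU (c : E →+* E) (rfl : ((StdForm.antidiagonal 3).over E) = ((StdForm.antidiagonal 3).over E)))) *
          ((heisChart hc (algebraMap E (AdeleRing (𝓞 E) E) p.1, traceZeroLine F E c hcδ hδ (algebraMap F (AdeleRing (𝓞 F) F) p.2)) : ↥(adelicUnipotent F E c 3)) :
            (quasiSplit F E c 3).Adelic) * y) : ℝ)) ^ τ)
      = ∑' p : E × F, (fun q => ENNReal.ofReal (g q)) (ι p) := tsum_congr fun p => by rw [hterm p]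
    _ ≤ ∑' q, ENNReal.ofReal (g q) := ENNReal.tsum_comp_le_tsum_of_injective hinj _
    _ = ENNReal.ofReal (∑' q, g q) := (ENNReal.ofReal_tsum_of_nonneg (fun q => Real.rpow_nonneg (NNReal.coe_nonneg _) τ) hsum).symm
    _ ≤ ENNReal.ofReal (A₁ * ((max (borelHeight y) (borelHeight y)⁻¹ : ℝ≥0) : ℝ) ^ τ) := ENNReal.ofReal_le_ofReal hle

/-! ## §3 The centre-line mass `∫_{𝔸_F} H(ι(w₀)·u(X, θ t)·g)^σ dμ_F(t)` is finite, for every `X` and `g` -/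

/-- The centre line `t ↦ u(X, θ t)` is continuous (★ `heisChart`, ★ `traceZeroLine` are homeomorphisms). [cite: Rogawski1990, §1.10] -/
theorem continuous_coe_heisChart_traceZeroLine (hc : c * c = 1) (hcδ : c δ = -δ) (hδ : δ ≠ 0) (X : AdeleRing (𝓞 E) E) :
    Continuous fun t : AdeleRing (𝓞 F) F => ((heisChart hc (X, traceZeroLine F E c hcδ hδ t) : ↥(adelicUnipotent F E c 3)) : (quasiSplit F E c 3).Adelic) :=
  continuous_subtype_val.comp ((heisChart hc).continuous.comp (continuous_const.prodMk (traceZeroLine F E c hcδ hδ).continuous))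

/-- The shell terms `t ↦ H(w · (u(X, θ t) · g))^σ` along the centre line are measurable (continuous: ★ `continuous_borelHeight`; `σ ≥ 0`). [cite: Rogawski1990, §1.10] -/
theorem measurable_ofReal_borelHeight_mul_heisChart_line_rpow (hc : c * c = 1) (hcδ : c δ = -δ) (hδ : δ ≠ 0) {σ : ℝ} (hσ : 0 ≤ σ)
    [MeasurableSpace (AdeleRing (𝓞 F) F)] [BorelSpace (AdeleRing (𝓞 F) F)] (w g : (quasiSplit F E c 3).Adelic) (X : AdeleRing (𝓞 E) E) :
    Measurable fun t : AdeleRing (𝓞 F) F => ENNReal.ofReal (((borelHeight (w *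
      (((heisChart hc (X, traceZeroLine F E c hcδ hδ t) : ↥(adelicUnipotent F E c 3)) : (quasiSplit F E c 3).Adelic) * g)) : ℝ)) ^ σ) :=
  (ENNReal.continuous_ofReal.comp (((NNReal.continuous_coe.comp continuous_borelHeight).comp
    (continuous_const.mul ((continuous_coe_heisChart_traceZeroLine hc hcδ hδ X).mul continuous_const))).rpow_const fun _ => Or.inr hσ)).measurable

/-- The integrand `t ↦ H(ι(w₀)·u(X, θ t)·g)^σ` of the centre-line mass is continuous (`σ ≥ 0`; ★ `continuous_borelHeight`). [cite: Rogawski1990, §1.10] -/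
theorem continuous_centreLine_borelHeight_rpow_three (hc : c * c = 1) (hcδ : c δ = -δ) (hδ : δ ≠ 0) {σ : ℝ} (hσ : 0 ≤ σ) (X : AdeleRing (𝓞 E) E) (g : (quasiSplit F E c 3).Adelic) :
    Continuous fun t : AdeleRing (𝓞 F) F => ((borelHeight (((quasiSplit F E c 3).toAdelic (weylLongU (c : E →+* E) (rfl : ((StdForm.antidiagonal 3).over E) = ((StdForm.antidiagonal 3).over E)))) *
        ((heisChart hc (X, traceZeroLine F E c hcδ hδ t) : ↥(adelicUnipotent F E c 3)) : (quasiSplit F E c 3).Adelic) * g) : ℝ)) ^ σ :=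
  ((NNReal.continuous_coe.comp continuous_borelHeight).comp
    ((continuous_const.mul (continuous_coe_heisChart_traceZeroLine hc hcδ hδ X)).mul continuous_const)).rpow_const fun _ => Or.inr hσ

/-- **THE CENTRE-LINE MASS IS DOMINATED BY THE EISENSTEIN SERIES** (`ℝ≥0∞` form): for `σ > 2` ONE `A₁ ≥ 0` with
`∫⁻_{𝔸_F} H(ι(w₀)·u(X, θ t)·g)^σ dμ_F(t) ≤ μ_F(D_F) · A₁ · max(H g, (H g)⁻¹)^σ` for EVERY `X ∈ 𝔸_E`, `g ∈ G(𝔸_F)` — unfold `𝔸_F = ⨆_{ξ ∈ F} (ξ + D_F)` (★ Tate), split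
`u(X, θ(ξ + t)) = u(0, θ ξ)·u(X, θ t)` (★ `heisChart_zero_mul`), interchange (Tonelli) and bound the `ξ`-sum by the `E × F`-shell of §2 at the base point `u(X, θ t)·g`, of height
`H(g)` (★ `borelHeight_unipotent_mul`). [cite: MoeglinWaldspurger1995, II.1.7] [cite: CasselsFrohlichANT1967, Ch. XV Thm. 4.1.3] [cite: Garrett2018, §2.8–§2.9] -/
theorem exists_forall_lintegral_centreLine_borelHeight_rpow_le_three (hc : c * c = 1) (hc1 : c ≠ 1) (hcδ : c δ = -δ) (hδ : δ ≠ 0)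
    (hIw : ∀ g : (quasiSplit F E c 3).Adelic, ∃ b ∈ borelAdelic F E c 3, ∃ k : (quasiSplit F E c 3).Adelic,
      adelicVal F E c 3 ((StdForm.antidiagonal 3).over E) k ∈ standardMaximalCompactGL 3 E ∧ g = b * k)
    [MeasurableSpace (AdeleRing (𝓞 F) F)] [BorelSpace (AdeleRing (𝓞 F) F)] (μF : Measure (AdeleRing (𝓞 F) F)) [μF.IsAddHaarMeasure]
    {σ : ℝ} (hσ : 2 < σ) :
    ∃ A₁ : ℝ, 0 ≤ A₁ ∧ ∀ (X : AdeleRing (𝓞 E) E) (g : (quasiSplit F E c 3).Adelic),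
      ∫⁻ t, ENNReal.ofReal (((borelHeight (((quasiSplit F E c 3).toAdelic (weylLongU (c : E →+* E) (rfl : ((StdForm.antidiagonal 3).over E) = ((StdForm.antidiagonal 3).over E)))) *
          ((heisChart hc (X, traceZeroLine F E c hcδ hδ t) : ↥(adelicUnipotent F E c 3)) : (quasiSplit F E c 3).Adelic) * g) : ℝ)) ^ σ) ∂μF ≤
        μF (adeleFundamentalDomain F) * ENNReal.ofReal (A₁ * ((max (borelHeight g) (borelHeight g)⁻¹ : ℝ≥0) : ℝ) ^ σ) := by
  classical
  haveI : Countable F := NumberField.countable' (K := F)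
  obtain ⟨A₁, hA₁, h⟩ := exists_forall_tsum_prod_borelHeight_heisChart_rpow_le_three hc hc1 hcδ hδ hIw hσ
  refine ⟨A₁, hA₁, fun X g => ?_⟩
  set W : (quasiSplit F E c 3).Adelic :=
    (quasiSplit F E c 3).toAdelic (weylLongU (c : E →+* E) (rfl : ((StdForm.antidiagonal 3).over E) = ((StdForm.antidiagonal 3).over E))) with hW
  -- the shell terms at the base point `u(X, θ t)·g`
  set G : E × F → AdeleRing (𝓞 F) F → ℝ≥0∞ := fun p t => ENNReal.ofReal (((borelHeight (W *
      ((heisChart hc (algebraMap E (AdeleRing (𝓞 E) E) p.1, traceZeroLine F E c hcδ hδ (algebraMap F (AdeleRing (𝓞 F) F) p.2)) : ↥(adelicUnipotent F E c 3)) : (quasiSplit F E c 3).Adelic) *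
      (((heisChart hc (X, traceZeroLine F E c hcδ hδ t) : ↥(adelicUnipotent F E c 3)) : (quasiSplit F E c 3).Adelic) * g)) : ℝ)) ^ σ) with hG
  have hGm : ∀ p, Measurable (G p) := fun p =>
    measurable_ofReal_borelHeight_mul_heisChart_line_rpow hc hcδ hδ (by linarith : (0 : ℝ) ≤ σ) _ g X
  -- unfold `𝔸_F = ⨆_ξ (ξ + D_F)` and recognise the shell term at `(0, ξ)`
  have h𝓓 := isAddFundamentalDomain_adeleFundamentalDomain F μF
  have hsplit : ∀ (ξ : F) (t : AdeleRing (𝓞 F) F), ENNReal.ofReal (((borelHeight (W *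
      ((heisChart hc (X, traceZeroLine F E c hcδ hδ (((principalSubgroupEquiv F ξ : AdeleRing.principalSubgroup (𝓞 F) F)) +ᵥ t)) : ↥(adelicUnipotent F E c 3)) :
        (quasiSplit F E c 3).Adelic) * g) : ℝ)) ^ σ) = G ((0 : E), ξ) t := by
    intro ξ t
    have hv : (((principalSubgroupEquiv F ξ : AdeleRing.principalSubgroup (𝓞 F) F)) +ᵥ t : AdeleRing (𝓞 F) F) = algebraMap F (AdeleRing (𝓞 F) F) ξ + t := rfl
    simp only [hG, map_zero]
    rw [hv, map_add, add_comm, ← heisChart_zero_mul hc X, Subgroup.coe_mul]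
    simp only [mul_assoc]
  rw [h𝓓.lintegral_eq_tsum'' fun t => ENNReal.ofReal (((borelHeight (W *
      ((heisChart hc (X, traceZeroLine F E c hcδ hδ t) : ↥(adelicUnipotent F E c 3)) : (quasiSplit F E c 3).Adelic) * g) : ℝ)) ^ σ),
    ← (principalSubgroupEquiv F).tsum_eq]
  simp_rw [hsplit]
  have hinj : Function.Injective fun ξ : F => ((0 : E), ξ) := fun ξ ξ' hξ => (Prod.mk.inj hξ).2
  calc ∑' ξ : F, ∫⁻ t in adeleFundamentalDomain F, G ((0 : E), ξ) t ∂μF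
      = ∫⁻ t in adeleFundamentalDomain F, ∑' ξ : F, G ((0 : E), ξ) t ∂μF := (lintegral_tsum fun ξ => (hGm ((0 : E), ξ)).aemeasurable).symm
    _ ≤ ∫⁻ _ in adeleFundamentalDomain F, ENNReal.ofReal (A₁ * ((max (borelHeight g) (borelHeight g)⁻¹ : ℝ≥0) : ℝ) ^ σ) ∂μF := by
        refine lintegral_mono fun t => ?_
        have hbase : borelHeight ((((heisChart hc (X, traceZeroLine F E c hcδ hδ t) : ↥(adelicUnipotent F E c 3)) : (quasiSplit F E c 3).Adelic) * g)) = borelHeight g :=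
          borelHeight_unipotent_mul (heisChart hc (X, traceZeroLine F E c hcδ hδ t)).2 g
        calc ∑' ξ : F, G ((0 : E), ξ) t ≤ ∑' p : E × F, G p t := ENNReal.tsum_comp_le_tsum_of_injective hinj (fun p => G p t)
          _ ≤ _ := by
              have h' := h ((((heisChart hc (X, traceZeroLine F E c hcδ hδ t) : ↥(adelicUnipotent F E c 3)) : (quasiSplit F E c 3).Adelic) * g))
              rw [hbase] at h'
              exact h'
    _ = ENNReal.ofReal (A₁ * ((max (borelHeight g) (borelHeight g)⁻¹ : ℝ≥0) : ℝ) ^ σ) * μF (adeleFundamentalDomain F) := setLIntegral_const _ _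
    _ = _ := mul_comm _ _

/-- **`h𝓔i` OF ★ PART II FOR `𝓔 = H^σ`: THE CENTRE-LINE FIBRE `t ↦ H(ι(w₀)·u(X, θ t)·g)^σ` IS INTEGRABLE ON `𝔸_F`** for every `X ∈ 𝔸_E`, `g ∈ G(𝔸_F)`, `σ > 2` (continuous, and of finite
mass by `exists_forall_lintegral_centreLine_borelHeight_rpow_le_three`; `D_F` has finite measure ★). [cite: MoeglinWaldspurger1995, II.1.7] [cite: CasselsFrohlichANT1967, Ch. XV Thm. 4.1.3] -/
theorem integrable_centreLine_borelHeight_rpow_three (hc : c * c = 1) (hc1 : c ≠ 1) (hcδ : c δ = -δ) (hδ : δ ≠ 0)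
    (hIw : ∀ g : (quasiSplit F E c 3).Adelic, ∃ b ∈ borelAdelic F E c 3, ∃ k : (quasiSplit F E c 3).Adelic,
      adelicVal F E c 3 ((StdForm.antidiagonal 3).over E) k ∈ standardMaximalCompactGL 3 E ∧ g = b * k)
    [MeasurableSpace (AdeleRing (𝓞 F) F)] [BorelSpace (AdeleRing (𝓞 F) F)] (μF : Measure (AdeleRing (𝓞 F) F)) [μF.IsAddHaarMeasure]
    {σ : ℝ} (hσ : 2 < σ) (X : AdeleRing (𝓞 E) E) (g : (quasiSplit F E c 3).Adelic) :
    Integrable (fun t : AdeleRing (𝓞 F) F => ((borelHeight (((quasiSplit F E c 3).toAdelic (weylLongU (c : E →+* E) (rfl : ((StdForm.antidiagonal 3).over E) = ((StdForm.antidiagonal 3).over E)))) *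
        ((heisChart hc (X, traceZeroLine F E c hcδ hδ t) : ↥(adelicUnipotent F E c 3)) : (quasiSplit F E c 3).Adelic) * g) : ℝ)) ^ σ) μF := by
  obtain ⟨A₁, -, h⟩ := exists_forall_lintegral_centreLine_borelHeight_rpow_le_three hc hc1 hcδ hδ hIw μF hσ
  refine ⟨(continuous_centreLine_borelHeight_rpow_three hc hcδ hδ (by linarith : (0 : ℝ) ≤ σ) X g).aestronglyMeasurable, ?_⟩
  rw [hasFiniteIntegral_iff_ofReal (ae_of_all _ fun t => Real.rpow_nonneg (NNReal.coe_nonneg _) σ)]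
  exact (h X g).trans_lt (ENNReal.mul_lt_top (measure_adeleFundamentalDomain_lt_top F μF) ENNReal.ofReal_lt_top)

/-- **`h𝓔N` OF ★ PART II FOR `𝓔 = H^σ` (Bochner form): `∫_{𝔸_F} H(ι(w₀)·u(X, θ t)·g)^σ dμ_F(t) ≤ N₁ · max(H g, (H g)⁻¹)^σ`** with ONE `N₁ ≥ 0` (`= μ_F(D_F)·A₁`) for every `X ∈ 𝔸_E`,
`g ∈ G(𝔸_F)`; for `g = k ∈ K_U` the right-hand side is the constant `N₁` (`H(k) = 1`). [cite: MoeglinWaldspurger1995, II.1.7] [cite: Garrett2018, §2.8–§2.9] -/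
theorem exists_forall_integral_centreLine_borelHeight_rpow_le_three (hc : c * c = 1) (hc1 : c ≠ 1) (hcδ : c δ = -δ) (hδ : δ ≠ 0)
    (hIw : ∀ g : (quasiSplit F E c 3).Adelic, ∃ b ∈ borelAdelic F E c 3, ∃ k : (quasiSplit F E c 3).Adelic,
      adelicVal F E c 3 ((StdForm.antidiagonal 3).over E) k ∈ standardMaximalCompactGL 3 E ∧ g = b * k)
    [MeasurableSpace (AdeleRing (𝓞 F) F)] [BorelSpace (AdeleRing (𝓞 F) F)] (μF : Measure (AdeleRing (𝓞 F) F)) [μF.IsAddHaarMeasure]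
    {σ : ℝ} (hσ : 2 < σ) :
    ∃ N₁ : ℝ, 0 ≤ N₁ ∧ ∀ (X : AdeleRing (𝓞 E) E) (g : (quasiSplit F E c 3).Adelic),
      ∫ t, ((borelHeight (((quasiSplit F E c 3).toAdelic (weylLongU (c : E →+* E) (rfl : ((StdForm.antidiagonal 3).over E) = ((StdForm.antidiagonal 3).over E)))) *
          ((heisChart hc (X, traceZeroLine F E c hcδ hδ t) : ↥(adelicUnipotent F E c 3)) : (quasiSplit F E c 3).Adelic) * g) : ℝ)) ^ σ ∂μF ≤
        N₁ * ((max (borelHeight g) (borelHeight g)⁻¹ : ℝ≥0) : ℝ) ^ σ := by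
  obtain ⟨A₁, hA₁, h⟩ := exists_forall_lintegral_centreLine_borelHeight_rpow_le_three hc hc1 hcδ hδ hIw μF hσ
  refine ⟨(μF (adeleFundamentalDomain F)).toReal * A₁, mul_nonneg ENNReal.toReal_nonneg hA₁, fun X g => ?_⟩
  have hM : 0 ≤ A₁ * ((max (borelHeight g) (borelHeight g)⁻¹ : ℝ≥0) : ℝ) ^ σ := mul_nonneg hA₁ (Real.rpow_nonneg (NNReal.coe_nonneg _) σ)
  rw [integral_eq_lintegral_of_nonneg_ae (ae_of_all _ fun t => Real.rpow_nonneg (NNReal.coe_nonneg _) σ)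
    (continuous_centreLine_borelHeight_rpow_three hc hcδ hδ (by linarith : (0 : ℝ) ≤ σ) X g).aestronglyMeasurable, mul_assoc, ← ENNReal.toReal_ofReal hM,
    ← ENNReal.toReal_mul]
  exact ENNReal.toReal_mono (ENNReal.mul_ne_top (measure_adeleFundamentalDomain_lt_top F μF).ne ENNReal.ofReal_ne_top) (h X g)

end Summit.HodgeConjecture.HodgeConjecture.Cruxes.H413.K2E1CentreLineMassU3

end
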